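import Literature.MathematicalPhysics.QuantumFieldTheory.Balaban1983to89.T4DressingDefect
import Literature.MathematicalPhysics.QuantumFieldTheory.Balaban1983to89.T4AdInvariant
import Literature.MathematicalPhysics.QuantumFieldTheory.Balaban1983to89.T4FirstOrderSize

/-!
# `Balaban1983to89.T4FlatExteriorInvariance` — constant-conjugation (global colour rotation) invariance of the
# conditional fibre law `E_t[· | V_out]` at a conjugation-fixed (e.g. FLAT) exterior; the kernel half of obligations
# O-α3 / O-α4 of row T4-O3.E-i′-Oα (audit cell `pub-balaban`, T4-DAG v4 §5, node O3b)

HONEST FRAMING.  Audit cell `pub-balaban`, unit `b2b-balaban-pv04` (gen 6), row **T4-O3.E-i′-Oα** of `HOME/t4/T4-DAG.md` v4 §5.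
ROW TEXT (task cell, verbatim): «(v4) obligations O-α3 + O-α4 of `t4/T4-EST-O3Ei1.md` v1.1 (G-pv16g4-6): O-α3 quote B15's norm
conventions and the (1.24)–(1.31) list of law (I)'s ingredients verbatim (pp.194–201) and confirm the measure E_t of (α0) term by
term; O-α4 covariance of U_{k,Z}, V_Λ and the minimiser map M(·) under CONSTANT conjugation (flat exterior ⇒ the critical orbit is
flat and the law (I) is Ad-invariant ⇒ `firstMoment_eq_zero_of_conj_invariant` applies) — cite B15/B11 loci or mark [analysis]».
(The consumer named in the row does not exist under that name; the tree's consumer is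
`T4AdInvariant.integral_eq_zero_of_conjEquivariant`, whose hypothesis `T4AdInvariant.FlatExteriorConjInvariant` this module SUPPLIES
for the cell's model `T4DressingDefect.condLaw` of `E_t[· | V_out]`.)  This is BOOKKEEPING for the cell's own first-order-size budget
(row T4-O3.E-i′), not a theorem of CMP 109/116/122 and not progress on any Clay-level statement; the cross-read of the printed
loci is the cell record `HOME/t4/T4-XREAD-O3Ei-alpha.md` (this unit), whose verbatim quotations are repeated below only as CONTEXT.
Every declaration here is tagged [folklore]: all are kernel-proved elementary facts about the cell's typed objects; no sentence
of the audited papers is used as a hypothesis.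

WHAT IS PRINTED (verbatim, render-certified in the XREAD record; locators = journal pages).
* Norm convention.  CMP 122 (B15) pp.175–202 contain no defining sentence for `|·|`; its reference [I] = CMP 109 (B12), p.252:
  «that it is a Lie subgroup of a group of complex unitary matrices, for example G⊂U(N).» … «where tr is the normalized trace,
  i.e. tr1 = 1.» … «Renormalization transformations are defined by averaging operations. In the previous papers we have used the
  definition introduced in [12].», [12] = CMP 98 (B7), whose p.21 reads «In estimates we will use much more frequently another norm
  for matrices. It is the operator norm given by |X| = sup|Xψ| …, |φ| = |ψ| = 1 … (19)» and (20) «|trX| ≤ |X|, ‖X‖ ≤ |X|,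
  |X| ≤ √N‖X‖, |XY| ≤ |X||Y|, ‖XY‖ ≤ ‖X‖‖Y‖».  (The tree's interface `GaugeGroup` axiomatises exactly `dist1 = |· − 1|` with
  `dist1_conj`, `reTr_conj`; [cite: Balaban1985Averaging, (19) p.21] is its tag.)
* The cut-off family of law (I) (B15): p.178 (1.3) «χ({sup_{p⊂□~}|U_{j,□}(V_j,∂p) − 1| < ε_j(L^{k−j}η)²})», (1.5) «χ({|V_j(y,x) − 1|
  < ε_j})», (1.6) «(1/z)exp[−(1/g_j²)[1 − Retr V_j(y,x)]]», (1.7) «χ({sup_{b∈(□′~2)^{(k)*}}|V_j(b)(V^{(j)}_{□′}(b))⁻¹ − 1| < 2δ_j})»,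
  (1.9) «χ({sup|A_j(b)| < g_j⁻¹δ_j})»; p.181 (1.22) «χ_k^{(0)} = χ({|U^{(0)}_{k,Z}(∂p) − 1| < (1 − β½)ε_h(L^{k−h}η)² for
  p∈Ω_h∖Ω_{h+1}})» and the list (1.24) (pp.181–182), every line of the form «·|U^{(n)}_{k,Z}(∂p) − 1| < … for p∈…», ending
  «where c = 1 for j < k, and c = 3 for j = k. We choose the number β satisfying 0 < β ≤ 1/2 … e.g., we can take β = 1/2»;
  p.182 (1.26) «V_Z^{(j)} = M^j(U^{(j+1−h)}_{k,Z})», (1.27) «χ′_j = χ({|V_j(b)(V_Z^{(j)}(b))⁻¹ − 1| < 2δ′_j for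
  b∈(Ω^c_{j+1}∖Z″_{j+1})^{(j)*}})»; p.183 «Let us notice that all the characteristic functions introduced above depend on the
  field variables localized in the corresponding components of the large field region Z_k.»; p.192 (1.72) «𝕋″^{(j)}(Z″_{j+1}) =
  ∫dV_j⌈_{Z″_{j+1}}δ(V̄_jV_{j+1}⁻¹)», (1.74) «U_{k,Z} = U_{k,Z}(V_k) = U(𝔹_k(Z), M^•(Q_k^{s*}V_k))»; p.193 (1.75) «χ_{k,Λ} =
  χ({inf_{V_k⌈_Λ} sup_{p∈Ω^c_k}|U_{k,Z}(∂p) − 1| < 2ε_kη²}). The restriction introduced by this function is on the field V_k⌈_{Z∩Λ^c}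
  only.»; p.197 (1.88) «1 = Σ_P ∏_{□⊂P^c}χ({sup_{p⊂□~}|U_{h,□}((1,V_h),∂p) − 1| < ½ε_h(L^{k−h}η)²})·∏_{□⊂P}χ({… ≥ ½ε_h(L^{k−h}η)²})».
* The O-α4 sentence, B15 p.197: «Changing the gauge of U₀ in the integral (1.76) requires the corresponding compensating gauge
  transformations of the variables V_h, the gauge transformation restricted to ∂⁺(Z′_h^~)^{(h)}, and of the variables V′, the gauge
  transformation in the adjoint representation. The expressions in the integral (1.76) are invariant with respect to these
  transformations. We can also choose from the beginning the configuration U₀ in the AL-gauge.»; and CMP 102 (B11) p.278: «The space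
  U_k({Ω_j},ε₀) is gauge invariant, and the space 𝔅_k(𝔅_k,V) is invariant with respect to gauge transformations u satisfying u(y) = 1
  for y∈𝔅_k. (4)» … «This space and the action (5) are invariant with respect to the gauge transformations (4). These transformations
  form a group and the space (6) is a union of orbits of this group. Our problem is to find all critical orbits of the functional (5).
  We will prove that for ε₀ sufficiently small there is at most one critical orbit.»

WHAT THE KERNEL PROVES (all [folklore]; `conjFun g U = (b ↦ g U(b) g⁻¹)` = the gauge transformation `u ≡ g`, `conjFun_eq_gaugeAct`).
§1 ALGEBRA OF CONSTANT CONJUGATION on the cell's typed objects: plaquette variables co-rotate (`plaqHol_conjFun`), so every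
   absolute cut-off `χ({|U(∂p) − 1| < δ, p ∈ S})` and the Wilson action are invariant (`plaqSmallOn_conjFun`, `chiSmall_conjInvariant`,
   `wilsonAction_conjInvariant` — the shape of (1.3), (1.22), (1.24), (1.75), (1.88) and of `A`); bond class-function cut-offs
   (`conjInvariant_bond`, shape of (1.5) and of the weight (1.6) for one bond variable; the Lie-algebra-valued cut-offs (1.8), (1.9) live
   in the adjoint representation and are NOT modelled — the tree has no typed `A`-field law); RELATIVE cut-offs `|V(b)W(b)⁻¹ − 1| < δ`
   are invariant under JOINT rotation of field and background and under rotation of the field alone at a rotation-fixed background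
   (`relBondSmallOn_conjFun`, `…_of_fixed` — the shape of (1.7), (1.27), (1.82)); the tree-gauge predicate `U⌈_T = 1` is invariant
   (`treeGauge_conjFun`) — in the fibre model of `T4DressingDefect` a δ-constraint `δ_{T₀}` is realised by EXCLUDING the constrained
   bonds from the fibre `s`, so they belong to the exterior, where `V = 1` is conjugation-fixed (`conjFixedOff_of_flat`), and the
   averaging constraint `δ(V̄_j V_{j+1}⁻¹)` of (1.72) is a covariant constraint surface (`Averaging.constraint_conjFun`); contour
   variables, the axial gauge and the gauge-fixing function co-rotate / are invariant (`ContourData.holTo_conjFun`, `axialGauge_conjFun`,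
   `gaugeFixFn_conjInvariant` — (1.5)/(1.6)); one-step and iterated averages are COVARIANT (`Averaging.avg_conjFun`,
   `Averaging.iter_conjFun` — O-α4 (ii) for `M^j`, from the axiom `Averaging.covariant` of `Setup`), and so is the axiomatic group
   average (`GroupAverage.M_conjFun`); closure of `ConjInvariant` under products/compositions (the density of law (I) is a product).
§2 MEASURE CORE: Haar measure is conjugation invariant (`haar_map_conj`, from the two one-sided invariances of `HaarData` alone), hence
   so is the product Haar measure on a fibre (`pi_haar_map_conjFun`); a general transport lemma (`map_withDensity_eq_of_invariant`);
   and THE MAIN THEOREM `fibreLaw_map_conjFun` / `condLaw_map_conjFun`: if the integrated density `old` is `ConjInvariant` and the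
   exterior configuration is fixed by conjugation by `g` off the fibre `s` (`ConjFixedOff s g V`; a FLAT exterior `V⌈_{sᶜ} = 1` is fixed
   by every `g`, `conjFixedOff_of_flat`), then the fibre law and the conditional law `E_t[· | V_out]` of `T4DressingDefect` are invariant
   under simultaneous conjugation of the fibre variables.  Exterior-only (fibre-constant) positive factors — the printed (1.75)
   «restriction … on the field V_k⌈_{Z∩Λ^c} only» — cancel in the conditional law (`condLaw_fibreConst_mul`).
§3 HAND-OFF for `G = SU(2)` (instances of `UnitaryModel`): `flatExteriorConjInvariant_condLaw` supplies
   `T4AdInvariant.FlatExteriorConjInvariant (condLaw s old V) T4AdInvariant.conjAll`; corollaries: a conjugation-equivariant pointwise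
   traceless matrix-valued insert has conditional mean `0` (`integral_condLaw_eq_zero`), entrywise in the `T4FirstOrderSize.MeanVanishes`
   currency (`meanVanishes_condLaw`, under the integrability binder that makes "entry of the mean = mean of the entry" honest).
§4 THE ABSTRACT O-α4 (iii) STEP [analysis in the record; elementary here]: an invariant functional on an invariant domain with a
   minimiser unique up to a relation `R` has an `R`-invariant minimiser (`rel_minimiser_of_unique`); a covariant map sends fixed
   inputs to fixed outputs (`fixed_of_covariant`, `Averaging.iter_fixed_of_fixed`).  The EXISTENCE and UNIQUENESS of the critical orbit
   (B15 Proposition 1 p.194 / B11 p.278) and «M(1,…,1) = 1» are NOT derived (they are not consequences of the typed axioms) — they stay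
   hypotheses of whoever instantiates `old`.
NOT CLAIMED: that Bałaban's law (I) at a given exterior IS of the form `condLaw s old V` with `ConjInvariant old` (the record's
term-by-term table argues it from the printed loci; the identification of `old` is row O3.E-i′'s, not a kernel statement); anything
about non-constant gauge transformations beyond `conjInvariant_of_gaugeInvariant`; O-α6, O-β3, O-γ2; any estimate.
-/

open scoped BigOperators ENNReal
open _root_.MeasureTheory Function Finset

namespace Literature.MathematicalPhysics.QuantumFieldTheory.Balaban1983to89.T4FlatExteriorInvariance

open GaugeField T4DressingDefect T4AdInvariant T4FirstOrderSize

/-! ## §1 Constant conjugation on configurations, cut-offs, actions, averages -/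

section Algebra

variable {P : Params} {j : ℕ} {G : Type*} [GaugeGroup G]

/-- Simultaneous conjugation `y ↦ (i ↦ g · y i · g⁻¹)` of a family of group elements (a gauge field `U : GaugeField P j G`, or a point
`y : s → G` of a fibre) by a CONSTANT `g` — the global colour rotation. [folklore] -/
def conjFun {ι : Type*} (g : G) (y : ι → G) : ι → G := fun i => g * y i * g⁻¹

/-- Pointwise form of `conjFun`. [folklore] -/
@[simp] theorem conjFun_apply {ι : Type*} (g : G) (y : ι → G) (i : ι) : conjFun g y i = g * y i * g⁻¹ := rfl

/-- Constant conjugation IS the gauge transformation `u ≡ g` (`GaugeField.gaugeAct`). [folklore] -/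
theorem conjFun_eq_gaugeAct (g : G) (U : GaugeField P j G) : conjFun g U = gaugeAct (fun _ => g) U := rfl

/-- For the record: the consumer's `T4AdInvariant.conjAll` (SU(2)) is this map. [folklore] -/
theorem conjAll_eq_conjFun {ι : Type*} (h : Matrix.specialUnitaryGroup (Fin 2) ℂ) :
    conjAll (ι := ι) h = conjFun h := rfl

/-- Conjugation by `1` is the identity. [folklore] -/
theorem conjFun_one {ι : Type*} (y : ι → G) : conjFun (1 : G) y = y := by
  funext i; simp [conjFun]

/-- `conj_{gh} = conj_g ∘ conj_h` (an action). [folklore] -/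
theorem conjFun_mul {ι : Type*} (g h : G) (y : ι → G) : conjFun (g * h) y = conjFun g (conjFun h y) := by
  funext i; simp only [conjFun, mul_inv_rev]; group

/-- `conj_{g⁻¹}` undoes `conj_g`. [folklore] -/
theorem conjFun_inv_conjFun {ι : Type*} (g : G) (y : ι → G) : conjFun g⁻¹ (conjFun g y) = y := by
  rw [← conjFun_mul, inv_mul_cancel, conjFun_one]

/-- `conj_g` undoes `conj_{g⁻¹}`. [folklore] -/
theorem conjFun_conjFun_inv {ι : Type*} (g : G) (y : ι → G) : conjFun g (conjFun g⁻¹ y) = y := by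
  rw [← conjFun_mul, mul_inv_cancel, conjFun_one]

/-- The flat configuration is fixed by every constant conjugation. [folklore] -/
theorem conjFun_const_one {ι : Type*} (g : G) : conjFun g (fun _ : ι => (1 : G)) = fun _ => 1 := by
  funext i; simp [conjFun]

/-- The flat gauge field `U ≡ 1` is fixed by every constant conjugation. [folklore] -/
theorem conjFun_unitField (g : G) : conjFun g (1 : GaugeField P j G) = (1 : GaugeField P j G) :=
  conjFun_const_one (ι := PBond P j) g

/-- Invariance of a function of the gauge field under all constant conjugations. [folklore] -/
def ConjInvariant {α : Sort*} (F : GaugeField P j G → α) : Prop :=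
  ∀ (g : G) (U : GaugeField P j G), F (conjFun g U) = F U

/-- Gauge invariance (`GaugeField.GaugeInvariant`) implies invariance under constant conjugation. [folklore] -/
theorem conjInvariant_of_gaugeInvariant {α : Type*} {F : GaugeField P j G → α} (hF : GaugeInvariant F) :
    ConjInvariant F :=
  fun g U => hF (fun _ => g) U

namespace ConjInvariant

variable {α β γ : Type*}

/-- Constants are conjugation invariant. [folklore] -/
theorem const (a : α) : ConjInvariant (fun _ : GaugeField P j G => a) := fun _ _ => rfl

/-- Post-composition preserves conjugation invariance. [folklore] -/
theorem comp {F : GaugeField P j G → α} (hF : ConjInvariant F) (φ : α → β) : ConjInvariant (φ ∘ F) :=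
  fun g U => by simp only [Function.comp_apply, hF g U]

/-- Binary combinations of invariant functions are invariant. [folklore] -/
theorem comp₂ {F₁ : GaugeField P j G → α} {F₂ : GaugeField P j G → β} (h₁ : ConjInvariant F₁) (h₂ : ConjInvariant F₂)
    (φ : α → β → γ) : ConjInvariant fun U => φ (F₁ U) (F₂ U) :=
  fun g U => by simp only [h₁ g U, h₂ g U]

/-- Products of invariant density factors are invariant (the density of law (I) is a product of cut-offs, δ-constraints and
`exp` of an invariant action). [folklore] -/
theorem mul {F₁ F₂ : GaugeField P j G → ℝ} (h₁ : ConjInvariant F₁) (h₂ : ConjInvariant F₂) : ConjInvariant (F₁ * F₂) :=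
  fun g U => by simp only [Pi.mul_apply, h₁ g U, h₂ g U]

/-- Finite products of invariant real factors are invariant. [folklore] -/
theorem prod {ι : Type*} (t : Finset ι) {F : ι → GaugeField P j G → ℝ} (h : ∀ i ∈ t, ConjInvariant (F i)) :
    ConjInvariant fun U => ∏ i ∈ t, F i U :=
  fun g U => Finset.prod_congr rfl fun i hi => h i hi g U

/-- Finite sums of invariant real functions are invariant (actions are sums of local terms). [folklore] -/
theorem sum {ι : Type*} (t : Finset ι) {F : ι → GaugeField P j G → ℝ} (h : ∀ i ∈ t, ConjInvariant (F i)) :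
    ConjInvariant fun U => ∑ i ∈ t, F i U :=
  fun g U => Finset.sum_congr rfl fun i hi => h i hi g U

/-- `exp` of an invariant action is an invariant density factor. [folklore] -/
theorem exp {F : GaugeField P j G → ℝ} (h : ConjInvariant F) : ConjInvariant fun U => Real.exp (F U) := h.comp Real.exp

end ConjInvariant

/-! ### Plaquette variables, absolute cut-offs, the Wilson action -/

/-- Plaquette variables co-rotate: `(conj_g U)(∂p) = g U(∂p) g⁻¹`. [folklore] -/
theorem plaqHol_conjFun (g : G) (U : GaugeField P j G) (p : Plaq P j) :
    plaqHol (conjFun g U) p = g * plaqHol U p * g⁻¹ := by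
  simp only [plaqHol, conjFun_apply, mul_inv_rev, inv_inv]; group

/-- `|U(∂p) − 1|` is invariant (operator norm is unitarily invariant: `GaugeGroup.dist1_conj`, B7 (19)). [folklore] -/
theorem dist1_plaqHol_conjFun (g : G) (U : GaugeField P j G) (p : Plaq P j) :
    dist1 (plaqHol (conjFun g U) p) = dist1 (plaqHol U p) := by
  rw [plaqHol_conjFun]; exact GaugeGroup.dist1_conj _ _

/-- `Re tr U(∂p)` is invariant (`GaugeGroup.reTr_conj`). [folklore] -/
theorem reTr_plaqHol_conjFun (g : G) (U : GaugeField P j G) (p : Plaq P j) :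
    reTr (plaqHol (conjFun g U) p) = reTr (plaqHol U p) := by
  rw [plaqHol_conjFun]; exact GaugeGroup.reTr_conj _ _

/-- Every ABSOLUTE small-field condition `|U(∂p) − 1| < δ, p ∈ S` — the shape of (1.3), (1.22), each line of (1.24), (1.75), (1.88) —
is invariant under constant conjugation. [folklore] -/
theorem plaqSmallOn_conjFun (S : Set (Plaq P j)) (δ : ℝ) (g : G) (U : GaugeField P j G) :
    PlaqSmallOn S δ (conjFun g U) ↔ PlaqSmallOn S δ U := by
  simp only [PlaqSmallOn, dist1_plaqHol_conjFun]

/-- The global small-field condition `|U(∂p) − 1| < δ` (all `p`) is conjugation invariant. [folklore] -/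
theorem plaqSmall_conjFun (δ : ℝ) (g : G) (U : GaugeField P j G) : PlaqSmall δ (conjFun g U) ↔ PlaqSmall δ U := by
  simp only [PlaqSmall, dist1_plaqHol_conjFun]

/-- The characteristic function `χ({|U(∂p) − 1| < δ, p ∈ S})` is conjugation invariant. [folklore] -/
theorem chiSmall_conjInvariant (S : Set (Plaq P j)) (δ : ℝ) : ConjInvariant (chiSmall (G := G) S δ) := fun g U => by
  unfold chiSmall
  by_cases h : PlaqSmallOn S δ U
  · rw [if_pos h, if_pos ((plaqSmallOn_conjFun S δ g U).mpr h)]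
  · rw [if_neg h, if_neg (mt (plaqSmallOn_conjFun S δ g U).mp h)]

/-- The LARGE-field indicator `χ({… ≥ δ})` of (1.88) (complement of the small-field condition) is conjugation invariant. [folklore] -/
theorem one_sub_chiSmall_conjInvariant (S : Set (Plaq P j)) (δ : ℝ) : ConjInvariant fun U : GaugeField P j G => 1 - chiSmall S δ U :=
  (chiSmall_conjInvariant S δ).comp fun x => 1 - x

/-- The Wilson action `Σ_p w[1 − Re tr U(∂p)]` (B12 (0.2)) is conjugation invariant. [folklore] -/
theorem wilsonAction_conjInvariant (w : ℝ) : ConjInvariant (wilsonAction (P := P) (j := j) (G := G) w) := fun g U => by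
  simp only [wilsonAction, reTr_plaqHol_conjFun]

/-! ### Bond class-function cut-offs and relative cut-offs against a background -/

/-- A class function on `G` (invariant under inner automorphisms). [folklore] -/
def IsClassFun {α : Sort*} (f : G → α) : Prop := ∀ g x : G, f (g * x * g⁻¹) = f x

/-- `|· − 1|` is a class function (`GaugeGroup.dist1_conj`, B7 (19)). [folklore] -/
theorem isClassFun_dist1 : IsClassFun (dist1 : G → ℝ) := fun g x => GaugeGroup.dist1_conj x g

/-- `Re tr` is a class function (`GaugeGroup.reTr_conj`). [folklore] -/
theorem isClassFun_reTr : IsClassFun (reTr : G → ℝ) := fun g x => GaugeGroup.reTr_conj x g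

/-- A cut-off / weight that is a class function of ONE bond variable — the shape of (1.5) `χ({|V_j(y,x) − 1| < ε_j})` and of (1.6)
`exp[−(1/g_j²)[1 − Re tr V_j(y,x)]]` for a bond variable — is conjugation invariant. [folklore] -/
theorem conjInvariant_bond {α : Sort*} {f : G → α} (hf : IsClassFun f) (b : PBond P j) :
    ConjInvariant fun U : GaugeField P j G => f (U b) :=
  fun g U => hf g (U b)

/-- `g a g⁻¹ (g c g⁻¹)⁻¹ = g (a c⁻¹) g⁻¹`. [folklore] -/
theorem conj_mul_conj_inv (g a c : G) : g * a * g⁻¹ * (g * c * g⁻¹)⁻¹ = g * (a * c⁻¹) * g⁻¹ := by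
  simp only [mul_inv_rev, inv_inv]; group

/-- `|g a g⁻¹ (g c g⁻¹)⁻¹ − 1| = |a c⁻¹ − 1|`: a relative distance is invariant under JOINT rotation. [folklore] -/
theorem dist1_rel_conj (g a c : G) : dist1 (g * a * g⁻¹ * (g * c * g⁻¹)⁻¹) = dist1 (a * c⁻¹) := by
  rw [conj_mul_conj_inv]; exact GaugeGroup.dist1_conj _ _

/-- RELATIVE small-field condition against a background `W`: `|U(b) W(b)⁻¹ − 1| < δ` for `b ∈ S` — the shape of (1.7)
(background `V^{(j)}_{□′}`), (1.27) (background `V_Z^{(j)} = M^j(U_{k,Z})`) and (1.82). [folklore] -/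
def RelBondSmallOn (S : Set (PBond P j)) (δ : ℝ) (W U : GaugeField P j G) : Prop :=
  ∀ b ∈ S, dist1 (U b * (W b)⁻¹) < δ

/-- A relative cut-off is invariant when field AND background are rotated together. [folklore] -/
theorem relBondSmallOn_conjFun (S : Set (PBond P j)) (δ : ℝ) (g : G) (W U : GaugeField P j G) :
    RelBondSmallOn S δ (conjFun g W) (conjFun g U) ↔ RelBondSmallOn S δ W U := by
  simp only [RelBondSmallOn, conjFun_apply, dist1_rel_conj]

/-- … hence invariant under rotation of the field alone whenever the background is rotation-FIXED (O-α4: a background that is a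
covariant function of a rotation-fixed exterior, `fixed_of_covariant` below). [folklore] -/
theorem relBondSmallOn_conjFun_of_fixed (S : Set (PBond P j)) (δ : ℝ) {g : G} {W : GaugeField P j G} (hW : conjFun g W = W)
    (U : GaugeField P j G) : RelBondSmallOn S δ W (conjFun g U) ↔ RelBondSmallOn S δ W U := by
  conv_lhs => rw [← hW]
  exact relBondSmallOn_conjFun S δ g W U

/-! ### Tree-gauge δ-constraints, indicator factors -/

/-- The tree-gauge constraint `U⌈_T = 1` as a predicate (the `δ_{T₀}` constraint of (1.76); in the fibre model it is realised by keeping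
`T` outside the fibre `s` with `V⌈_T = 1`, cf. `conjFixedOff_of_flat`). [folklore] -/
def TreeGauge (T : Set (PBond P j)) (U : GaugeField P j G) : Prop := ∀ b ∈ T, U b = 1

/-- The tree-gauge predicate is conjugation invariant (`g x g⁻¹ = 1 ↔ x = 1`). [folklore] -/
theorem treeGauge_conjFun (T : Set (PBond P j)) (g : G) (U : GaugeField P j G) :
    TreeGauge T (conjFun g U) ↔ TreeGauge T U := by
  simp only [TreeGauge, conjFun_apply, conj_eq_one_iff]

open Classical in
/-- The indicator (as a real density factor) of a predicate on configurations. [folklore] -/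
noncomputable def indicatorFn (Q : GaugeField P j G → Prop) (U : GaugeField P j G) : ℝ := if Q U then 1 else 0

/-- The indicator of a conjugation-invariant predicate is a conjugation-invariant density factor. [folklore] -/
theorem indicatorFn_conjInvariant {Q : GaugeField P j G → Prop} (hQ : ∀ (g : G) (U : GaugeField P j G), Q (conjFun g U) ↔ Q U) :
    ConjInvariant (indicatorFn Q) := fun g U => by
  unfold indicatorFn
  by_cases h : Q U
  · rw [if_pos h, if_pos ((hQ g U).mpr h)]
  · rw [if_neg h, if_neg (mt (hQ g U).mp h)]

/-- The indicator of the tree-gauge predicate is conjugation invariant. [folklore] -/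
theorem indicatorFn_treeGauge_conjInvariant (T : Set (PBond P j)) : ConjInvariant (indicatorFn (TreeGauge (G := G) T)) :=
  indicatorFn_conjInvariant (treeGauge_conjFun T)

/-- The indicator of a relative cut-off against a rotation-fixed background is conjugation invariant ((1.7)/(1.27)/(1.82) at a fixed
background). [folklore] -/
theorem indicatorFn_relBondSmallOn_conjInvariant (S : Set (PBond P j)) (δ : ℝ) {W : GaugeField P j G} (hW : ∀ g : G, conjFun g W = W) :
    ConjInvariant (indicatorFn (RelBondSmallOn S δ W)) :=
  indicatorFn_conjInvariant fun g U => relBondSmallOn_conjFun_of_fixed S δ (hW g) U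

/-! ### Contour variables, axial gauge, gauge-fixing function, averages -/

/-- Averaged contour variables co-rotate: `U^g(y,x) = g U(y,x) g⁻¹` (from the axiom `ContourData.covariant`). [folklore] -/
theorem _root_.Literature.MathematicalPhysics.QuantumFieldTheory.Balaban1983to89.ContourData.holTo_conjFun
    (cd : ContourData P j G) (g : G) (U : GaugeField P j G) (y : Site P (j+1)) (x : Site P j) :
    cd.holTo (conjFun g U) y x = g * cd.holTo U y x * g⁻¹ := by
  rw [conjFun_eq_gaugeAct]; exact cd.covariant (fun _ => g) U y x

/-- The axial gauge condition is conjugation invariant. [folklore] -/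
theorem axialGauge_conjFun (cd : ContourData P j G) (g : G) (U : GaugeField P j G) :
    AxialGauge cd (conjFun g U) ↔ AxialGauge cd U := by
  simp only [AxialGauge, cd.holTo_conjFun, conj_eq_one_iff]

/-- The gauge-fixing function `Σ_y Σ_{x≠y} [1 − Re tr U(y,x)]` (the exponent of (1.6)) is conjugation invariant. [folklore] -/
theorem gaugeFixFn_conjInvariant (cd : ContourData P j G) (Y : Finset (Site P (j+1))) : ConjInvariant (gaugeFixFn cd Y) :=
  fun g U => by simp only [gaugeFixFn, cd.holTo_conjFun, GaugeGroup.reTr_conj]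

/-- ONE-STEP AVERAGES ARE COVARIANT under constant conjugation (in range): `avg (conj_g U) = conj_g (avg U)` — the axiom
`Averaging.covariant` of `Setup` at `u ≡ g`.  O-α4 (ii), one step. [folklore] -/
theorem _root_.Literature.MathematicalPhysics.QuantumFieldTheory.Balaban1983to89.Averaging.avg_conjFun
    (av : Averaging P j G) (hj : j + 1 ≤ P.m + P.K) (g : G) (U : GaugeField P j G) :
    av.avg (conjFun g U) = conjFun g (av.avg U) := by
  rw [conjFun_eq_gaugeAct, av.covariant hj]; rfl

/-- The averaging constraint surface `{U : Ū = W}` (the `δ(V̄_j V_{j+1}⁻¹)` of (1.25), (1.72)) is covariant: it is carried to the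
constraint surface of the rotated coarse field, hence is invariant when the coarse field is rotation-fixed. [folklore] -/
theorem _root_.Literature.MathematicalPhysics.QuantumFieldTheory.Balaban1983to89.Averaging.constraint_conjFun
    (av : Averaging P j G) (hj : j + 1 ≤ P.m + P.K) (g : G) {U : GaugeField P j G} {W : GaugeField P (j+1) G} :
    av.avg (conjFun g U) = conjFun g W ↔ av.avg U = W := by
  rw [av.avg_conjFun hj]
  constructor
  · intro h
    have h' := congrArg (conjFun g⁻¹) h
    rwa [conjFun_inv_conjFun, conjFun_inv_conjFun] at h'
  · intro h; rw [h]

/-- … hence the constraint surface against a rotation-FIXED coarse field is conjugation invariant. [folklore] -/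
theorem _root_.Literature.MathematicalPhysics.QuantumFieldTheory.Balaban1983to89.Averaging.constraint_conjFun_of_fixed
    (av : Averaging P j G) (hj : j + 1 ≤ P.m + P.K) {g : G} {U : GaugeField P j G} {W : GaugeField P (j+1) G}
    (hW : conjFun g W = W) : av.avg (conjFun g U) = W ↔ av.avg U = W := by
  conv_lhs => rw [← hW]
  exact av.constraint_conjFun hj g

/-- ITERATED AVERAGES `M^k` ARE COVARIANT (O-α4 (ii) for the background `V_Z^{(j)} = M^j(U_{k,Z})` of (1.26)/(1.27)). [folklore] -/
theorem _root_.Literature.MathematicalPhysics.QuantumFieldTheory.Balaban1983to89.Averaging.iter_conjFun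
    (av : ∀ i, Averaging P i G) :
    ∀ (k : ℕ), k ≤ P.m + P.K → ∀ (g : G) (U : GaugeField P 0 G), Averaging.iter av k (conjFun g U) = conjFun g (Averaging.iter av k U)
  | 0, _, _, _ => rfl
  | k+1, hk, g, U => by
    show (av k).avg (Averaging.iter av k (conjFun g U)) = conjFun g ((av k).avg (Averaging.iter av k U))
    rw [Averaging.iter_conjFun av k (by omega) g U, (av k).avg_conjFun (by omega)]

/-- The axiomatic group average `M` (B12 (0.5)–(0.7)) is conjugation covariant on its domain (axiom (0.6) at `u = g`, `v = g⁻¹`).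
[folklore] -/
theorem _root_.Literature.MathematicalPhysics.QuantumFieldTheory.Balaban1983to89.GroupAverage.M_conjFun
    (ga : GroupAverage G) {n : ℕ} (U : Fin (n+1) → G) (hU : FamilySmall ga.δ U) (g : G) :
    ga.M (conjFun g U) = g * ga.M U * g⁻¹ :=
  ga.equivariant U hU g g⁻¹

/-- The small-diameter domain of `M` is conjugation invariant. [folklore] -/
theorem familySmall_conjFun (δ : ℝ) {n : ℕ} (g : G) (U : Fin (n+1) → G) : FamilySmall δ (conjFun g U) ↔ FamilySmall δ U := by
  simp only [FamilySmall, conjFun_apply, dist1_rel_conj]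

/-! ### §4 (placed here, pure algebra) The abstract O-α4 (iii) step -/

/-- UNIQUENESS ⇒ INVARIANCE.  An `A`-preserving self-map `T` of an `A`-invariant… domain `D` maps a minimiser `x₀` of `A` on `D` to a
minimiser; if minimisers are unique up to the relation `R` (e.g. "same gauge orbit"), then `R (T x₀) x₀` — for `T =` constant
conjugation: the critical ORBIT is conjugation-stable.  (B11 p.278: «at most one critical orbit»; existence/uniqueness itself is a
hypothesis here.) [folklore] -/
theorem rel_minimiser_of_unique {X : Type*} (A : X → ℝ) (D : Set X) (T : X → X) (hTD : ∀ x ∈ D, T x ∈ D)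
    (hTA : ∀ x, A (T x) = A x) (R : X → X → Prop) {x₀ : X} (hx₀ : x₀ ∈ D) (hmin : ∀ z ∈ D, A x₀ ≤ A z)
    (huniq : ∀ x ∈ D, (∀ z ∈ D, A x ≤ A z) → R x x₀) : R (T x₀) x₀ :=
  huniq (T x₀) (hTD x₀ hx₀) fun z hz => by rw [hTA]; exact hmin z hz

/-- With plain uniqueness (a unique minimiser, e.g. after gauge fixing), the minimiser is `T`-fixed. [folklore] -/
theorem minimiser_fixed_of_unique {X : Type*} (A : X → ℝ) (D : Set X) (T : X → X) (hTD : ∀ x ∈ D, T x ∈ D)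
    (hTA : ∀ x, A (T x) = A x) {x₀ : X} (hx₀ : x₀ ∈ D) (hmin : ∀ z ∈ D, A x₀ ≤ A z)
    (huniq : ∀ x ∈ D, (∀ z ∈ D, A x ≤ A z) → x = x₀) : T x₀ = x₀ :=
  rel_minimiser_of_unique A D T hTD hTA (· = ·) hx₀ hmin huniq

/-- COVARIANT MAP + FIXED INPUT ⇒ FIXED OUTPUT (the minimiser map `V_out ↦ V_Λ(V_out)`, the background maps `U_{k,Z}(·)`, `M^j(·)`:
at a conjugation-fixed — e.g. flat — exterior the background is conjugation-fixed). [folklore] -/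
theorem fixed_of_covariant {α β : Type*} (M : α → β) (Tα : α → α) (Tβ : β → β) (hM : ∀ a, M (Tα a) = Tβ (M a)) {a : α}
    (ha : Tα a = a) : Tβ (M a) = M a := by
  rw [← hM, ha]

/-- Instance: the iterated average of a conjugation-fixed configuration is conjugation-fixed; in particular `M^k` of a flat exterior
continuation is fixed by every constant conjugation as soon as the input is. [folklore] -/
theorem _root_.Literature.MathematicalPhysics.QuantumFieldTheory.Balaban1983to89.Averaging.iter_fixed_of_fixed
    (av : ∀ i, Averaging P i G) (k : ℕ) (hk : k ≤ P.m + P.K) {g : G} {U : GaugeField P 0 G} (hU : conjFun g U = U) :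
    conjFun g (Averaging.iter av k U) = Averaging.iter av k U :=
  fixed_of_covariant (Averaging.iter av k) (conjFun g) (conjFun g) (Averaging.iter_conjFun av k hk g) hU

end Algebra

/-! ## §2 The measure core: Haar, product Haar, fibre law and conditional law -/

section MeasureCore

variable {P : Params} {j : ℕ} {G : Type*} [GaugeGroup G] [MeasurableSpace G]

/-- Constant conjugation of a family is measurable (measurable multiplication suffices). [folklore] -/
theorem measurable_conjFun [MeasurableMul G] {ι : Type*} (g : G) : Measurable (conjFun (ι := ι) g) := by
  refine measurable_pi_lambda _ fun i => ?_
  show Measurable fun c : ι → G => g * c i * g⁻¹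
  have hi : Measurable fun c : ι → G => c i := measurable_pi_apply i
  exact (hi.const_mul g).mul_const g⁻¹

/-- Constant conjugation as a measurable automorphism of the family space (inverse: conjugation by `g⁻¹`). [folklore] -/
def conjEquiv [MeasurableMul G] (ι : Type*) (g : G) : (ι → G) ≃ᵐ (ι → G) where
  toFun := conjFun g
  invFun := conjFun g⁻¹
  left_inv := conjFun_inv_conjFun g
  right_inv := conjFun_conjFun_inv g
  measurable_toFun := measurable_conjFun g
  measurable_invFun := measurable_conjFun g⁻¹

/-- The underlying map of `conjEquiv` is `conjFun`. [folklore] -/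
@[simp] theorem coe_conjEquiv [MeasurableMul G] (ι : Type*) (g : G) : ⇑(conjEquiv ι g) = conjFun g := rfl

variable [HaarData G]

/-- HAAR MEASURE IS CONJUGATION INVARIANT — from the two one-sided invariances recorded in `HaarData` (no uniqueness of Haar measure
is used). [folklore] -/
theorem haar_map_conj [MeasurableMul G] (g : G) :
    (HaarData.haar : Measure G).map (fun h => g * h * g⁻¹) = HaarData.haar := by
  rw [show (fun h : G => g * h * g⁻¹) = (fun h => h * g⁻¹) ∘ (fun h => g * h) from rfl,
    ← Measure.map_map (measurable_mul_const g⁻¹) (measurable_const_mul g), HaarData.map_mul_left, HaarData.map_mul_right]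

/-- The product Haar measure on a family space is invariant under simultaneous conjugation. [folklore] -/
theorem pi_haar_map_conjFun [MeasurableMul G] {ι : Type*} [Fintype ι] (g : G) :
    (Measure.pi fun _ : ι => (HaarData.haar : Measure G)).map (conjFun g) = Measure.pi fun _ : ι => HaarData.haar := by
  have hσ : ∀ _i : ι, SigmaFinite ((HaarData.haar : Measure G).map fun h => g * h * g⁻¹) := fun _ => by
    rw [haar_map_conj]; infer_instance
  calc (Measure.pi fun _ : ι => (HaarData.haar : Measure G)).map (conjFun g)
      = Measure.pi fun _ : ι => (HaarData.haar : Measure G).map fun h => g * h * g⁻¹ :=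
        Measure.pi_map_pi (μ := fun _ : ι => (HaarData.haar : Measure G)) (f := fun _ h => g * h * g⁻¹)
          fun _ => ((measurable_const_mul g).mul_const g⁻¹).aemeasurable
    _ = Measure.pi fun _ : ι => (HaarData.haar : Measure G) := by simp only [haar_map_conj]

omit [GaugeGroup G] [MeasurableSpace G] [HaarData G] in
/-- TRANSPORT LEMMA: a measurable automorphism preserving `ν` and the density preserves `ν.withDensity d`. [folklore] -/
theorem map_withDensity_eq_of_invariant {X : Type*} [MeasurableSpace X] (ν : Measure X) (e : X ≃ᵐ X) (hν : ν.map e = ν)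
    (d : X → ℝ≥0∞) (hd : d ∘ e = d) : (ν.withDensity d).map e = ν.withDensity d := by
  ext A hA
  have hA' : MeasurableSet (e ⁻¹' A) := hA.preimage e.measurable
  rw [e.map_apply, withDensity_apply _ hA', withDensity_apply _ hA]
  calc ∫⁻ x in e ⁻¹' A, d x ∂ν = ∫⁻ x in e ⁻¹' A, (d ∘ e) x ∂ν := by rw [hd]
    _ = ∫⁻ y in A, d y ∂(ν.map e) := by rw [e.measurableEmbedding.restrict_map, lintegral_map_equiv]; rfl
    _ = ∫⁻ y in A, d y ∂ν := by rw [hν]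

variable [DecidableEq (PBond P j)]

/-- THE EXTERIOR IS FIXED BY CONJUGATION BY `g` OFF THE FIBRE `s`: `g V(b) g⁻¹ = V(b)` for `b ∉ s`.  A FLAT exterior (`V⌈_{sᶜ} = 1`,
the tree-gauge / unit configuration) is fixed by every `g` (`conjFixedOff_of_flat`); more generally any exterior with values in the
centraliser of `g`. [folklore] -/
def ConjFixedOff (s : Finset (PBond P j)) (g : G) (V : GaugeField P j G) : Prop := ∀ b ∉ s, g * V b * g⁻¹ = V b

omit [MeasurableSpace G] [HaarData G] [DecidableEq (PBond P j)] in
/-- A FLAT exterior `V⌈_{sᶜ} = 1` is fixed by every constant conjugation. [folklore] -/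
theorem conjFixedOff_of_flat {s : Finset (PBond P j)} {V : GaugeField P j G} (hV : ∀ b ∉ s, V b = 1) (g : G) :
    ConjFixedOff s g V := fun b hb => by
  rw [hV b hb]; simp

omit [MeasurableSpace G] [HaarData G] [DecidableEq (PBond P j)] in
/-- The unit configuration is fixed off every fibre. [folklore] -/
theorem conjFixedOff_unitField (s : Finset (PBond P j)) (g : G) : ConjFixedOff s g (1 : GaugeField P j G) :=
  conjFixedOff_of_flat (fun _ _ => rfl) g

omit [MeasurableSpace G] [HaarData G] in
/-- KEY IDENTITY: at a `g`-fixed exterior, conjugating the fibre variables and then inserting them equals inserting and then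
conjugating the whole configuration: `V←(conj_g y) = conj_g (V←y)`. [folklore] -/
theorem updateFinset_conjFun {s : Finset (PBond P j)} {g : G} {V : GaugeField P j G} (hV : ConjFixedOff s g V) (y : s → G) :
    updateFinset V s (conjFun g y) = conjFun g (updateFinset V s y) := by
  funext b
  by_cases hb : b ∈ s
  · simp only [updateFinset, conjFun_apply, dif_pos hb]
  · simp only [updateFinset, conjFun_apply, dif_neg hb, hV b hb]

/-- MAIN THEOREM (fibre law).  If the integrated density `old` is invariant under constant conjugation and the exterior `V⌈_{sᶜ}` is
fixed by conjugation by `g`, the fibre law of `T4DressingDefect` through `V` is invariant under simultaneous conjugation of the fibre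
variables by `g`.  Cf. the printed O-α4 sentence (B15 p.197) «The expressions in the integral (1.76) are invariant with respect to
these transformations.» — here for the CONSTANT transformation, where no compensating transformation of a fixed exterior is needed.
[folklore] -/
theorem fibreLaw_map_conjFun [MeasurableMul G] (s : Finset (PBond P j)) {old : Density P j G} (hold : ConjInvariant old) {g : G}
    {V : GaugeField P j G} (hV : ConjFixedOff s g V) :
    (fibreLaw s old V).map (conjFun g) = fibreLaw s old V := by
  have h := map_withDensity_eq_of_invariant (Measure.pi fun _ : s => (HaarData.haar : Measure G)) (conjEquiv (↥s) g)
    (pi_haar_map_conjFun g) (fun y => ENNReal.ofReal (old (updateFinset V s y))) (by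
      funext y
      simp only [Function.comp_apply, coe_conjEquiv, updateFinset_conjFun hV, hold g])
  unfold fibreLaw
  simpa only [coe_conjEquiv] using h

/-- MAIN THEOREM (conditional law `E_t[· | V_out]`): the normalised fibre law is invariant under simultaneous conjugation of the fibre
variables, under the same hypotheses. [folklore] -/
theorem condLaw_map_conjFun [MeasurableMul G] (s : Finset (PBond P j)) {old : Density P j G} (hold : ConjInvariant old) {g : G}
    {V : GaugeField P j G} (hV : ConjFixedOff s g V) :
    (condLaw s old V).map (conjFun g) = condLaw s old V := by
  unfold condLaw
  rw [Measure.map_smul, fibreLaw_map_conjFun s hold hV]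

/-- At a FLAT exterior both laws are invariant under EVERY constant conjugation. [folklore] -/
theorem condLaw_map_conjFun_of_flat [MeasurableMul G] (s : Finset (PBond P j)) {old : Density P j G} (hold : ConjInvariant old)
    {V : GaugeField P j G} (hV : ∀ b ∉ s, V b = 1) (g : G) :
    (condLaw s old V).map (conjFun g) = condLaw s old V :=
  condLaw_map_conjFun s hold (conjFixedOff_of_flat hV g)

/-- Invariance of conditional expectations: `E_t[f ∘ conj_g | V_out] = E_t[f | V_out]` for every integrand (change of variables along a
measure-preserving measurable automorphism; no integrability needed). [folklore] -/
theorem integral_condLaw_conjFun [MeasurableMul G] (s : Finset (PBond P j)) {old : Density P j G} (hold : ConjInvariant old) {g : G}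
    {V : GaugeField P j G} (hV : ConjFixedOff s g V) {E : Type*} [NormedAddCommGroup E] [NormedSpace ℝ E] (f : (s → G) → E) :
    ∫ y, f (conjFun g y) ∂(condLaw s old V) = ∫ y, f y ∂(condLaw s old V) := by
  have h := MeasureTheory.integral_map_equiv (conjEquiv (↥s) g) (μ := condLaw s old V) f
  rw [coe_conjEquiv, condLaw_map_conjFun s hold hV] at h
  exact h.symm

/-! ### Exterior-only factors cancel in the conditional law ((1.75): «The restriction introduced by this function is on the field
V_k⌈_{Z∩Λ^c} only.») -/

/-- A density factor that is CONSTANT ALONG THE FIBRE through `V` (depends on `V⌈_{sᶜ}` only) scales the fibre law. [folklore] -/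
theorem fibreLaw_fibreConst_mul (s : Finset (PBond P j)) {e old : Density P j G} {V : GaugeField P j G}
    (he : ∀ y : s → G, e (updateFinset V s y) = e V) (hV : 0 ≤ e V) :
    fibreLaw s (e * old) V = ENNReal.ofReal (e V) • fibreLaw s old V := by
  unfold fibreLaw
  rw [← withDensity_smul' _ _ ENNReal.ofReal_ne_top]
  congr 1
  funext y
  simp only [Pi.mul_apply, Pi.smul_apply, smul_eq_mul, he y, ENNReal.ofReal_mul hV]

/-- … and CANCELS in the conditional law: `E_t[· | V_out]` for the density `e·old` equals that for `old` whenever `e` is fibre-constant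
and positive at `V` (at `e V = 0` both sides are the zero measure only if one adopts the junk convention; not claimed). [folklore] -/
theorem condLaw_fibreConst_mul (s : Finset (PBond P j)) {e old : Density P j G} {V : GaugeField P j G}
    (he : ∀ y : s → G, e (updateFinset V s y) = e V) (hV : 0 < e V) :
    condLaw s (e * old) V = condLaw s old V := by
  have hc0 : ENNReal.ofReal (e V) ≠ 0 := by rwa [Ne, ENNReal.ofReal_eq_zero, not_le]
  have hcT : ENNReal.ofReal (e V) ≠ ⊤ := ENNReal.ofReal_ne_top
  unfold condLaw
  rw [fibreLaw_fibreConst_mul s he hV.le, Measure.smul_apply, smul_eq_mul, smul_smul,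
    ENNReal.mul_inv (Or.inl hc0) (Or.inl hcT), mul_right_comm, ENNReal.inv_mul_cancel hc0 hcT, one_mul]

end MeasureCore

/-! ## §3 Hand-off for `G = SU(2)`: the hypothesis of `T4AdInvariant` supplied; mean zero of equivariant traceless inserts -/

section HandOff

variable {P : Params} {j : ℕ} [DecidableEq (PBond P j)]

/-- THE HAND-OFF.  For `G = SU(2)` (the `GaugeGroup`/`RegularGaugeGroup`/`HaarData` instances of `UnitaryModel`), a conjugation-invariant
integrated density and an exterior fixed by every constant conjugation off the fibre (e.g. a FLAT exterior) make the conditional law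
`E_t[· | V_out]` a `T4AdInvariant.FlatExteriorConjInvariant` law for the simultaneous-conjugation action `conjAll`. [folklore] -/
theorem flatExteriorConjInvariant_condLaw (s : Finset (PBond P j)) {old : Density P j (Matrix.specialUnitaryGroup (Fin 2) ℂ)} (hold : ConjInvariant old)
    {V : GaugeField P j (Matrix.specialUnitaryGroup (Fin 2) ℂ)} (hV : ∀ h : (Matrix.specialUnitaryGroup (Fin 2) ℂ), ConjFixedOff s h V) :
    FlatExteriorConjInvariant (condLaw s old V) (conjAll (ι := ↥s)) :=
  fun h => ⟨(measurable_conjFun (ι := ↥s) h).aemeasurable, condLaw_map_conjFun s hold (hV h)⟩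

/-- The same at a flat exterior `V⌈_{sᶜ} = 1`. [folklore] -/
theorem flatExteriorConjInvariant_condLaw_of_flat (s : Finset (PBond P j)) {old : Density P j (Matrix.specialUnitaryGroup (Fin 2) ℂ)} (hold : ConjInvariant old)
    {V : GaugeField P j (Matrix.specialUnitaryGroup (Fin 2) ℂ)} (hV : ∀ b ∉ s, V b = 1) :
    FlatExteriorConjInvariant (condLaw s old V) (conjAll (ι := ↥s)) :=
  flatExteriorConjInvariant_condLaw s hold fun h => conjFixedOff_of_flat hV h

/-- MEAN ZERO: a conjugation-equivariant, pointwise traceless, matrix-valued insert has conditional mean `0` at such an exterior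
(`T4AdInvariant.integral_eq_zero_of_conjEquivariant`; junk-safe, no integrability). [folklore] -/
theorem integral_condLaw_eq_zero (s : Finset (PBond P j)) {old : Density P j (Matrix.specialUnitaryGroup (Fin 2) ℂ)} (hold : ConjInvariant old)
    {V : GaugeField P j (Matrix.specialUnitaryGroup (Fin 2) ℂ)} (hV : ∀ h : (Matrix.specialUnitaryGroup (Fin 2) ℂ), ConjFixedOff s h V) {f : (↥s → (Matrix.specialUnitaryGroup (Fin 2) ℂ)) → Fin 2 → Fin 2 → ℂ}
    (hf : ConjEquivariant (conjAll (ι := ↥s)) f) (htr : ∀ y, f y 0 0 + f y 1 1 = 0) :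
    ∫ y, f y ∂(condLaw s old V) = 0 :=
  integral_eq_zero_of_conjEquivariant (flatExteriorConjInvariant_condLaw s hold hV) hf htr

/-- ENTRY OF THE MEAN = MEAN OF THE ENTRY for an integrable matrix-valued integrand (evaluation is a continuous linear map). [folklore] -/
theorem integral_apply_apply {X : Type*} [MeasurableSpace X] {μ : Measure X} {f : X → Fin 2 → Fin 2 → ℂ} (hf : Integrable f μ)
    (i k : Fin 2) : (∫ x, f x ∂μ) i k = ∫ x, f x i k ∂μ := by
  have h := ((ContinuousLinearMap.proj (R := ℝ) (φ := fun _ : Fin 2 => ℂ) k).comp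
    (ContinuousLinearMap.proj (R := ℝ) (φ := fun _ : Fin 2 => Fin 2 → ℂ) i)).integral_comp_comm hf
  simpa using h.symm

/-- THE `MeanVanishes` CURRENCY of `T4FirstOrderSize` (entrywise, `E = ℂ`): for a family of inserts `B · b`, `b ∈ S`, each conjugation
equivariant, pointwise traceless and integrable under the conditional law, the conditional mean field vanishes on `S`, entry by
entry. [folklore] -/
theorem meanVanishes_condLaw (s : Finset (PBond P j)) {old : Density P j (Matrix.specialUnitaryGroup (Fin 2) ℂ)} (hold : ConjInvariant old)
    {V : GaugeField P j (Matrix.specialUnitaryGroup (Fin 2) ℂ)} (hV : ∀ h : (Matrix.specialUnitaryGroup (Fin 2) ℂ), ConjFixedOff s h V) {β : Type*} (S : Finset β)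
    (B : (↥s → (Matrix.specialUnitaryGroup (Fin 2) ℂ)) → β → Fin 2 → Fin 2 → ℂ) (hB : ∀ b ∈ S, ConjEquivariant (conjAll (ι := ↥s)) fun y => B y b)
    (htr : ∀ b ∈ S, ∀ y, B y b 0 0 + B y b 1 1 = 0) (hint : ∀ b ∈ S, Integrable (fun y => B y b) (condLaw s old V))
    (i k : Fin 2) : MeanVanishes S (meanField (condLaw s old V) fun y b => B y b i k) := by
  intro b hb
  show (∫ y, B y b i k ∂(condLaw s old V)) = 0
  rw [← integral_apply_apply (hint b hb), integral_condLaw_eq_zero s hold hV (hB b hb) (htr b hb)]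
  rfl

end HandOff

end Literature.MathematicalPhysics.QuantumFieldTheory.Balaban1983to89.T4FlatExteriorInvariance
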